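import Summits.QuantumFields.BalabanUV.T4Continuum.Spine.NE1p.DressedSmallFieldTBoxMixedLetterThirdRadius

/-!
# T⁴ programme, spine estimate NE1′ (node O3b/H2) — THE SOURCE DERIVATIVE COMMUTES INTO THE (1.23)∕(2.14) LETTER: for `E(μ; t_□, σ)`
# jointly analytic in the source and the contour variables, `∂∕∂μ (1.23)(E(μ)) = (1.23)(∂E∕∂μ(μ))` — the source derivative of the expansion
# term IS the expansion term of the source derivative (symmetric second partials of analytic maps at every vertex of the decoupling cube),
# at EVERY order `∂^k∕∂μ^k`; (1.24)'s shape for the source derivatives in the currency `sup‖∂_μ^k E‖`; W98's third radius RE-DERIVED by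
# Cauchy on `E` itself — the two routes give the same bound and, on the decided datum, the same numeral

Cell `pub-balaban`, sub-cell `t4`, row NE1′ formalisation crew (`t4/formal/NE1p/LEAVES.md` row W⟨next⟩ — own-initiative DICTIONARY follower of
the unit's W98 «THE THIRD RADIUS» (p244458), W93 (p244127) and W89 (p242876) under typer R-T61 (ii); g13's NATURAL NEXT (b)), unit
`b2b-balaban-t4-ne1p-formalise-leaf-08` (gen 14).  ADDITIVE — imports W98 `Spine/NE1p/DressedSmallFieldTBoxMixedLetterThirdRadius` ONLY
(`norm_deriv_le_of_strict_window`, `analyticOnNhd_source_toy`; → W93 `deriv_slice_eq_fderiv`∕`analyticOnNhd_deriv_slice`∕`analyticOnNhd_section`∕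
`analyticOnNhd_vertexSlice`∕`tBoxMixedLetter_eq_spectator`; W89 `deriv_mixedDiff`∕`tBoxMixedLetter_eq_mixedDiff_deriv_local`∕`norm_tBoxMixedLetter_le`;
W76 `mixedDiff_eq_sum_powerset`; W57 `isOpen_polyBall`; W55 `analyticOnNhd_apply`; W39.1 `mixedDiff`∕`μS`∕`wS`∕`σS`∕`mixedDiff_pair`; the NE5
substrate's `w₁`∕`circ`; the template's `polydisc` — all BY NAME) + Mathlib (`AnalyticOnNhd.fderiv`, `ContinuousLinearMap.apply`,
`ContDiffAt.isSymmSndFDerivAt_of_omega`, `HasFDerivAt.clm_apply`, `iteratedDeriv_succ`, `Filter.EventuallyEq.deriv_eq`).  THEOREMS ONLY + decided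
`example`s; 0 `def`, 0 `instance`, 0 `def … : Prop`, 0 cite, 0 sorry, 0 `attribute`; nothing upstream restated (W98 §3 is USED BY NAME in §5's
consistency `example`, next to the other route; never re-declared).

WHY THIS FILE.  W98 bounded `∂∕∂μ (1.23)(μ)` by Cauchy's estimate on the holomorphic function `μ ↦ (1.23)(μ)` (W93 at `P = ℂ`) WITHOUT saying
what that derivative IS.  The cell's (w5)∕(w6) currencies (trigger notes (n1)∕(n2): the μ-extension `E^{(k+1)}(X; μ)` and «termwise
μ-differentiation» are the CELL's, not print's) differentiate expansion terms in the observable source; the dictionary statement behind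
«termwise» is that the derivative of a (1.23)∕(2.14)-type term is again a term of the same type, with the factor `E` replaced by `∂E∕∂μ`.  Here:
* §1 [folklore] calculus on a product `ℂ × Q`: the first-slot slice derivative is the Fréchet derivative on `(1, 0)` (`deriv_slice_fst_eq_fderiv`);
  **`analyticOnNhd_deriv_slice_fst`**: `(μ, v) ↦ ∂g∕∂μ(μ, v)` is JOINTLY analytic on an open set of joint analyticity (Mathlib `AnalyticOnNhd.fderiv`),
  and so are all `∂^k g∕∂μ^k` (`analyticOnNhd_iteratedDeriv_slice_fst`); **`deriv_deriv_slice_comm`**: for `h` analytic on an open `U ⊆ ℂ × ℂ`,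
  `∂_μ ∂_t h = ∂_t ∂_μ h` on `U` (Mathlib `ContDiffAt.isSymmSndFDerivAt_of_omega` — the W60 mechanism on a product instead of a `Fin`-cube);
* §2 for `E(μ; t_□, σ)` jointly analytic on `W × {|t| < R₀} × Π_j{|σ_j| < R_{j+1}}` (`W ⊆ ℂ` open): **`deriv_mixedDiff_tDeriv_source`**
  `∂_μ Δ_S(∂E(μ′)∕∂t_□|₀) = Δ_S(∂_μ ∂_t E|₀)` (W89 §1 in the source variable; W93 §1 supplies the differentiability),
  **`mixedDiff_deriv_source_comm`** `Δ_S(∂_μ ∂_t E|₀) = Δ_S(∂_t|₀ ∂_μ E(μ))` (§1 at every vertex `𝟙_T`, W76's closed form), and the row's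
  statement **`deriv_tBoxMixedLetter_source`**: `∂∕∂μ|_μ ∫_{θ_□} w₁ ρ (0,θ_□)·(∫ wS r S p·E(μ′; circ ρ θ_□ ∷ σ_S p) d(⨂ μS S)) dθ_□ = ∫_{θ_□} w₁ ρ
  (0,θ_□)·(∫ wS r S p·∂E∕∂μ(μ; circ ρ θ_□ ∷ σ_S p) d(⨂ μS S)) dθ_□` — THE SOURCE DERIVATIVE OF THE (1.23) LETTER IS THE (1.23) LETTER OF THE
  SOURCE DERIVATIVE (near `μ` the letter is `Δ_S(∂E(μ′)∕∂t_□|₀)` by W93; then the two commutations; then W93 again on the analytic field `∂E∕∂μ`);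
* §3 **`iteratedDeriv_tBoxMixedLetter_source`**: the same at every order `k` — `∂^k∕∂μ^k (1.23)(E(·)) = (1.23)(∂^k E∕∂μ^k)` on `W` (induction;
  §1's joint analyticity of `∂^k E∕∂μ^k` re-enters §2) — the Taylor coefficients of the letter in the source are the letters of the Taylor
  coefficients of the factor;
* §4 **`norm_deriv_tBoxMixedLetter_source_le`∕`norm_iteratedDeriv_tBoxMixedLetter_source_le`**: (1.24)'s THREE-FACTOR SHAPE for the source
  derivatives, `‖∂^k∕∂μ^k (1.23)(μ)‖ ≤ ρ⁻¹·A_k·e^{−(κ₁−1)·#S}` under a sup bound `A_k` on `∂^k E∕∂μ^k(μ; ·)` over `{|t| = ρ} × {|z_j| ≤ e^{κ₁}}`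
  (HYPOTHESIS of (1.21)-TYPE for the derivative field; W89 `norm_tBoxMixedLetter_le` on §2∕§3); **`norm_deriv_source_le_of_strict_window`**:
  Cauchy on `E` ITSELF — `‖E(μ′; v)‖ ≤ A` for `|μ′| ≤ μ₁′` gives `A₁ = A∕(μ₁′ − μ₀)` on `|μ| ≤ μ₀ < μ₁′ < μ₁` (W98 §1 on the slice);
* §5 consistency and decided checks: W98 §3 `norm_deriv_letter_source_le` BY NAME next to the OTHER ROUTE (commute, then Cauchy on `E`),
  same number (`ring`) — an `example`; on W98's datum `E = μ²·t·z₀z₁` the commuted form computes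
  `∂_μ (1.23)(½) = (1.23)(2·½·t·z₀z₁) = Δ_{01}(z₀z₁) = 1` — W98 §4's numeral — and `∂²_μ (1.23)(μ) = (1.23)(2·t·z₀z₁) = 2` at every `|μ| < 2`.

HONEST FRAMING.  [folklore] several-complex-variables calculus (symmetric second partials and analyticity of derivatives of analytic maps,
Cauchy's estimate — Mathlib) + W93∕W89∕W76∕W98 BY NAME on OUR dictionary objects; a DICTIONARY row — what «termwise μ-differentiation» of a
(1.23)∕(2.14)-type term produces, NOT an estimate of print and NOT a statement about Bałaban's densities: the audited manuscript
[Balaban1988RGII] has no observable source `μ` (its `E^{(k+1)}(X; μ)` is the cell's extension, trigger note (n1); (n2) is a CELL record, GAPS-T4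
C-t4r2-340) — nothing of print is quoted here beyond W89's p. 7 loci (TYPE∕CONTEXT).  OWNER's RIDER (t4-ne1p-p1 g41, journal l.25202, verbatim): «an
identity for `E` JOINTLY analytic on `W ×ˢ polydisc` — for Bałaban's dressed small-field input that joint analyticity (source × contour variables,
with the (2.20)-type sup bounds `A_k`) is exactly the (w1)∕(B2) birth datum, NEW-UNPRINTED; the identity RELOCATES «termwise μ-differentiation»
(C-t4r2-340 (n1)∕(n2)) to that datum and discharges nothing of it; `A`∕`A₁`∕`A_k`, radii and the strict sub-window are HYPOTHESES; Lemma 3 ∕ C₃ ∕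
(1.25) untouched; wall v1.8 unmoved».  No numeral of [Balaban1988RGII] asserted (k2); (B1) for Bałaban's (2.14) NOT discharged; (B3) = GAPS
G-ne9p2-5 UNPRINTED — NOT discharged, untouched; (B5) untouched; (w5)∕(w6) NOT discharged (the strict sub-window stays DISPLAYED as
`μ₀ < μ₁′ < μ₁`); 0 binders instantiated on Bałaban's densities ∕ operators ∕ (2.14) data ∕ `d_k` ∕ minimisers ∕ backgrounds; discharges no wall
item; wall v1.8 (T4-DAG v48) does NOT move; R-t4r2-Q2 NOT met thereby; NE1′ ⇐ the named binders — NOT proved, NOT printed; spine PROVED 0∕9; count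
9 unchanged.  Rung (B)+1 on ONE finite four-torus — NOT infinite volume, NOT a mass gap, NOT OS on ℝ⁴, NOT Clay.  ABSOLUTE RULE honoured: no locus
of print is newly quoted; the referee notes and the owner's rider are CELL records quoted as such; nothing internally minted is cited as a fact;
[folklore] tags on kernel lemmas only.  HONEST DEPENDENCY: continuum YM on T⁴ ⇐ BetaPertH ∧ nine spine estimates (0/9 proved); BetaPertH ⇐ (D1) ∧
(D4) ∧ CAP+tail; G-an2-4 gates asym, D1 and NE2/3/4.
-/

noncomputable section

namespace Summit.QuantumFields.BalabanUV.T4Continuum.NE1p.DressedSmallFieldTBoxMixedLetterSourceCommute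

open MeasureTheory Metric Set Complex Finset Function Filter
open scoped BigOperators Topology
open Summit.QuantumFields.BalabanUV.T4Continuum.B13TermContours
open Summit.QuantumFields.BalabanUV.T4Continuum.NE1p.DressedSmallFieldMixedLetter
open Summit.QuantumFields.BalabanUV.T4Continuum.NE1p.DressedSmallFieldMixedDerivativeBridge (analyticOnNhd_apply)
open Summit.QuantumFields.BalabanUV.T4Continuum.NE1p.DressedSmallFieldMixedDerivativeLetterLocal (isOpen_polyBall)
open Summit.QuantumFields.BalabanUV.T4Continuum.NE1p.DressedSmallFieldMixedDifferenceClosedForm (mixedDiff_eq_sum_powerset)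
open Summit.QuantumFields.BalabanUV.T4Continuum.NE1p.DressedSmallFieldTBoxMixedLetterLocal
  (deriv_mixedDiff tBoxMixedLetter_eq_mixedDiff_deriv_local norm_tBoxMixedLetter_le)
open Summit.QuantumFields.BalabanUV.T4Continuum.NE1p.DressedSmallFieldTBoxMixedLetterSpectator
open Summit.QuantumFields.BalabanUV.T4Continuum.NE1p.DressedSmallFieldTBoxMixedLetterThirdRadius
open Literature.MathematicalPhysics.QuantumFieldTheory.Dimock2011to13.PolydiscCauchyBounds (polydisc)

variable {n : ℕ} {Q : Type*} [NormedAddCommGroup Q] [NormedSpace ℂ Q]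

/-! ## §1 [folklore] Calculus on a product `ℂ × Q`: slice derivatives in the first slot; symmetric second partials on `ℂ × ℂ` -/

/-- [folklore] The first-slot slice derivative is the Fréchet derivative on the direction `(1, 0)` (Mathlib `HasFDerivAt.comp_hasDerivAt`,
`HasDerivAt.prodMk`; W93 `deriv_slice_eq_fderiv` is the second-slot twin). -/
theorem deriv_slice_fst_eq_fderiv (g : ℂ × Q → ℂ) (v : Q) {μ₀ : ℂ} (hg : DifferentiableAt ℂ g (μ₀, v)) :
    deriv (fun μ : ℂ => g (μ, v)) μ₀ = fderiv ℂ g (μ₀, v) ((1 : ℂ), (0 : Q)) := by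
  have h1 : HasDerivAt (fun μ : ℂ => ((μ, v) : ℂ × Q)) ((1 : ℂ), (0 : Q)) μ₀ := (hasDerivAt_id μ₀).prodMk (hasDerivAt_const μ₀ v)
  exact (hg.hasFDerivAt.comp_hasDerivAt μ₀ h1).deriv

/-- **THE SOURCE DERIVATIVE OF A JOINTLY ANALYTIC MAP IS JOINTLY ANALYTIC** [folklore]: for `g : ℂ × Q → ℂ` analytic on an open `U`,
`(μ, v) ↦ ∂∕∂μ g(μ, v)` is analytic on `U` — Mathlib `AnalyticOnNhd.fderiv` (the Fréchet derivative of an analytic map is analytic) evaluated on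
`(1, 0)` by `ContinuousLinearMap.apply`, then `AnalyticOnNhd.congr` on the open `U`. -/
theorem analyticOnNhd_deriv_slice_fst {U : Set (ℂ × Q)} (hU : IsOpen U) {g : ℂ × Q → ℂ} (hg : AnalyticOnNhd ℂ g U) :
    AnalyticOnNhd ℂ (fun q : ℂ × Q => deriv (fun μ : ℂ => g (μ, q.2)) q.1) U := by
  have hev : AnalyticOnNhd ℂ (fun q : ℂ × Q => fderiv ℂ g q ((1 : ℂ), (0 : Q))) U :=
    ((ContinuousLinearMap.apply ℂ ℂ ((1 : ℂ), (0 : Q))).analyticOnNhd _).comp hg.fderiv (mapsTo_univ _ _)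
  exact hev.congr hU fun q hq => (deriv_slice_fst_eq_fderiv g q.2 (hg q hq).differentiableAt).symm

/-- [folklore] … and so are ALL the source derivatives `(μ, v) ↦ ∂^k g∕∂μ^k (μ, v)` (induction; Mathlib `iteratedDeriv_succ`). -/
theorem analyticOnNhd_iteratedDeriv_slice_fst {U : Set (ℂ × Q)} (hU : IsOpen U) {g : ℂ × Q → ℂ} (hg : AnalyticOnNhd ℂ g U) :
    ∀ k : ℕ, AnalyticOnNhd ℂ (fun q : ℂ × Q => iteratedDeriv k (fun μ : ℂ => g (μ, q.2)) q.1) U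
  | 0 => by simpa only [iteratedDeriv_zero] using hg
  | k + 1 => by
      simpa only [iteratedDeriv_succ] using
        analyticOnNhd_deriv_slice_fst hU (g := fun q : ℂ × Q => iteratedDeriv k (fun μ : ℂ => g (μ, q.2)) q.1)
          (analyticOnNhd_iteratedDeriv_slice_fst hU hg k)

/-- **SYMMETRIC SECOND PARTIALS ON A PRODUCT** (kernel; the W60 `pderiv_comm` mechanism on `ℂ × ℂ`: both iterated slice derivatives are the
second Fréchet derivative on the coordinate directions — W93 `deriv_slice_eq_fderiv`, §1's first-slot twin, `HasFDerivAt.clm_apply` — and Mathlib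
`ContDiffAt.isSymmSndFDerivAt_of_omega` (analytic ⇒ `C^ω` ⇒ symmetric `D²`)): for `h` analytic on an open `U ⊆ ℂ × ℂ` and `(a, b) ∈ U`,
`∂∕∂μ|_a ∂∕∂t|_b h(μ, t) = ∂∕∂t|_b ∂∕∂μ|_a h(μ, t)`. [folklore] -/
theorem deriv_deriv_slice_comm {U : Set (ℂ × ℂ)} (hU : IsOpen U) {h : ℂ × ℂ → ℂ} (hh : AnalyticOnNhd ℂ h U) {a b : ℂ}
    (hab : (a, b) ∈ U) :
    deriv (fun μ : ℂ => deriv (fun t : ℂ => h (μ, t)) b) a = deriv (fun t : ℂ => deriv (fun μ : ℂ => h (μ, t)) a) b := by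
  -- near `a` (resp. `b`) the inner slice derivative is the Fréchet derivative on `(0,1)` (resp. `(1,0)`)
  have hl : (fun μ : ℂ => deriv (fun t : ℂ => h (μ, t)) b) =ᶠ[𝓝 a] fun μ => fderiv ℂ h (μ, b) ((0 : ℂ), (1 : ℂ)) := by
    filter_upwards [(hU.preimage (Continuous.prodMk_left b)).mem_nhds hab] with μ hμ
    exact deriv_slice_eq_fderiv h μ (hh _ hμ).differentiableAt
  have hr : (fun t : ℂ => deriv (fun μ : ℂ => h (μ, t)) a) =ᶠ[𝓝 b] fun t => fderiv ℂ h (a, t) ((1 : ℂ), (0 : ℂ)) := by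
    filter_upwards [(hU.preimage (Continuous.prodMk_right a)).mem_nhds hab] with t ht
    exact deriv_slice_fst_eq_fderiv h t (hh _ ht).differentiableAt
  rw [hl.deriv_eq, hr.deriv_eq]
  -- the second Fréchet derivative
  have hD : HasFDerivAt (fderiv ℂ h) (fderiv ℂ (fderiv ℂ h) (a, b)) (a, b) := ((hh _ hab).fderiv.differentiableAt).hasFDerivAt
  have happ : ∀ w : ℂ × ℂ, HasFDerivAt (fun q : ℂ × ℂ => fderiv ℂ h q w)
      ((fderiv ℂ h (a, b)).comp (0 : (ℂ × ℂ) →L[ℂ] (ℂ × ℂ)) + (fderiv ℂ (fderiv ℂ h) (a, b)).flip w) (a, b) := fun w =>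
    hD.clm_apply (hasFDerivAt_const w (a, b))
  rw [deriv_slice_fst_eq_fderiv (fun q : ℂ × ℂ => fderiv ℂ h q ((0 : ℂ), (1 : ℂ))) b (happ _).differentiableAt,
    deriv_slice_eq_fderiv (fun q : ℂ × ℂ => fderiv ℂ h q ((1 : ℂ), (0 : ℂ))) a (happ _).differentiableAt,
    (happ _).fderiv, (happ _).fderiv]
  simpa using ((hh _ hab).contDiffAt.isSymmSndFDerivAt_of_omega) ((1 : ℂ), (0 : ℂ)) ((0 : ℂ), (1 : ℂ))

/-! ## §2 THE SOURCE DERIVATIVE COMMUTES INTO THE (1.23) LETTER -/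

/-- [folklore] For `E(μ; t_□, σ)` JOINTLY analytic on `W × {|t| < R₀} × Π_j{|σ_j| < R_{j+1}}` (`W ⊆ ℂ` open), the source-derivative field
`(μ, v) ↦ ∂E∕∂μ(μ; v)` is jointly analytic on the same set (§1). -/
theorem analyticOnNhd_deriv_source {W : Set ℂ} (hW : IsOpen W) {R : Fin (n + 1) → ℝ} {E : ℂ → (Fin (n + 1) → ℂ) → ℂ}
    (hE : AnalyticOnNhd ℂ (fun q : ℂ × (Fin (n + 1) → ℂ) => E q.1 q.2) (W ×ˢ Set.univ.pi fun j => ball (0 : ℂ) (R j))) :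
    AnalyticOnNhd ℂ (fun q : ℂ × (Fin (n + 1) → ℂ) => deriv (fun μ' : ℂ => E μ' q.2) q.1)
      (W ×ˢ Set.univ.pi fun j => ball (0 : ℂ) (R j)) :=
  analyticOnNhd_deriv_slice_fst (hW.prod (isOpen_polyBall R)) hE

/-- [folklore] … and so is every `(μ, v) ↦ ∂^k E∕∂μ^k (μ; v)`. -/
theorem analyticOnNhd_iteratedDeriv_source {W : Set ℂ} (hW : IsOpen W) {R : Fin (n + 1) → ℝ} {E : ℂ → (Fin (n + 1) → ℂ) → ℂ}
    (hE : AnalyticOnNhd ℂ (fun q : ℂ × (Fin (n + 1) → ℂ) => E q.1 q.2) (W ×ˢ Set.univ.pi fun j => ball (0 : ℂ) (R j))) (k : ℕ) :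
    AnalyticOnNhd ℂ (fun q : ℂ × (Fin (n + 1) → ℂ) => iteratedDeriv k (fun μ' : ℂ => E μ' q.2) q.1)
      (W ×ˢ Set.univ.pi fun j => ball (0 : ℂ) (R j)) :=
  analyticOnNhd_iteratedDeriv_slice_fst (hW.prod (isOpen_polyBall R)) hE k

/-- **`∂_μ Δ_S(∂E(μ′)∕∂t_□|₀) = Δ_S(∂_μ ∂_t E|₀)`** [folklore] — the source derivative commutes with the decoupling differences of the first
`t_□`-variation (W89 §1 `deriv_mixedDiff` in the source variable; the vertexwise differentiability in `μ′` of `∂∕∂t|₀ E(μ′; t ∷ 𝟙_T)` is W93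
§1∕§2 — the slice derivative of the jointly analytic vertex slice is analytic in the spectator `μ′`). -/
theorem deriv_mixedDiff_tDeriv_source {W : Set ℂ} (hW : IsOpen W) {R : Fin (n + 1) → ℝ} (hR0 : 0 < R 0) (h1 : ∀ j : Fin n, 1 < R j.succ)
    (S : Finset (Fin n)) {E : ℂ → (Fin (n + 1) → ℂ) → ℂ}
    (hE : AnalyticOnNhd ℂ (fun q : ℂ × (Fin (n + 1) → ℂ) => E q.1 q.2) (W ×ˢ Set.univ.pi fun j => ball (0 : ℂ) (R j)))
    {μ : ℂ} (hμ : μ ∈ W) :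
    deriv (fun μ' : ℂ => mixedDiff n S (fun w => deriv (fun t : ℂ => E μ' (Fin.cons t w)) 0)) μ =
      mixedDiff n S (fun w => deriv (fun μ' : ℂ => deriv (fun t : ℂ => E μ' (Fin.cons t w)) 0) μ) :=
  deriv_mixedDiff S (G := fun μ' w => deriv (fun t : ℂ => E μ' (Fin.cons t w)) 0) fun T _ =>
    ((analyticOnNhd_deriv_slice hW (g := fun q : ℂ × ℂ => E q.1 (Fin.cons q.2 fun i => if i ∈ T then (1 : ℂ) else 0))
      (analyticOnNhd_vertexSlice h1 hE T) (mem_ball_self hR0)) μ hμ).differentiableAt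

/-- **`Δ_S(∂_μ ∂_t E|₀)(μ) = Δ_S(∂_t|₀ ∂E∕∂μ(μ))`** [folklore] — at every vertex `𝟙_T` of the decoupling cube (inside the polydisc, radii
`> 1`) the two second partials of the analytic vertex slice `(μ′, t) ↦ E(μ′; t ∷ 𝟙_T)` agree (§1 `deriv_deriv_slice_comm`); W76's closed
form `mixedDiff_eq_sum_powerset` carries the vertexwise identity to `Δ_S`. -/
theorem mixedDiff_deriv_source_comm {W : Set ℂ} (hW : IsOpen W) {R : Fin (n + 1) → ℝ} (hR0 : 0 < R 0) (h1 : ∀ j : Fin n, 1 < R j.succ)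
    (S : Finset (Fin n)) {E : ℂ → (Fin (n + 1) → ℂ) → ℂ}
    (hE : AnalyticOnNhd ℂ (fun q : ℂ × (Fin (n + 1) → ℂ) => E q.1 q.2) (W ×ˢ Set.univ.pi fun j => ball (0 : ℂ) (R j)))
    {μ : ℂ} (hμ : μ ∈ W) :
    mixedDiff n S (fun w => deriv (fun μ' : ℂ => deriv (fun t : ℂ => E μ' (Fin.cons t w)) 0) μ) =
      mixedDiff n S (fun w => deriv (fun t : ℂ => deriv (fun μ' : ℂ => E μ' (Fin.cons t w)) μ) 0) := by
  rw [mixedDiff_eq_sum_powerset, mixedDiff_eq_sum_powerset]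
  refine sum_congr rfl fun T _ => ?_
  congr 1
  exact deriv_deriv_slice_comm (hW.prod isOpen_ball) (h := fun q : ℂ × ℂ => E q.1 (Fin.cons q.2 fun i => if i ∈ T then (1 : ℂ) else 0))
    (analyticOnNhd_vertexSlice h1 hE T) ⟨hμ, mem_ball_self hR0⟩

/-- **THE SOURCE DERIVATIVE OF THE (1.23) LETTER IS THE (1.23) LETTER OF THE SOURCE DERIVATIVE** (kernel; near `μ` the letter of `E(μ′)` is
`Δ_S(∂E(μ′)∕∂t_□|₀)` — W93 `tBoxMixedLetter_eq_spectator` on the open `W`, `Filter.EventuallyEq.deriv_eq` —, then `deriv_mixedDiff_tDeriv_source`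
and `mixedDiff_deriv_source_comm`, then W93 again on the jointly analytic field `∂E∕∂μ`): for `E(μ; t_□, σ)` JOINTLY analytic on
`W × {|t| < R₀} × Π_j{|σ_j| < R_{j+1}}`, the `t_□`-radius `0 < ρ < R₀`, contour radii `1 < r_j < R_{j+1}` and `μ ∈ W`,
`∂∕∂μ′|_μ ∫_{θ_□} w₁ ρ (0,θ_□)·(∫ wS r S p·E(μ′; circ ρ θ_□ ∷ σ_S p) d(⨂ μS S)) dθ_□
  = ∫_{θ_□} w₁ ρ (0,θ_□)·(∫ wS r S p·∂E∕∂μ(μ; circ ρ θ_□ ∷ σ_S p) d(⨂ μS S)) dθ_□`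
— the cell's «termwise μ-differentiation» (trigger note (n2), a CELL record) of a (1.23)∕(2.14)-type term yields a term OF THE SAME TYPE with the
factor replaced by its source derivative; the μ-extension itself is the cell's (note (n1)), nothing of print is claimed. [folklore] -/
theorem deriv_tBoxMixedLetter_source {W : Set ℂ} (hW : IsOpen W) {ρ : ℝ} (hρ : 0 < ρ) {r : Fin n → ℝ} {R : Fin (n + 1) → ℝ}
    (hρR : ρ < R 0) (hr : ∀ j, 1 < r j) (hrR : ∀ j : Fin n, r j < R j.succ) (S : Finset (Fin n)) {E : ℂ → (Fin (n + 1) → ℂ) → ℂ}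
    (hE : AnalyticOnNhd ℂ (fun q : ℂ × (Fin (n + 1) → ℂ) => E q.1 q.2) (W ×ˢ Set.univ.pi fun j => ball (0 : ℂ) (R j)))
    {μ : ℂ} (hμ : μ ∈ W) :
    deriv (fun μ' : ℂ => ∫ θ₀ in Icc 0 (2 * Real.pi), w₁ ρ (0, θ₀) *
        ∫ p, wS r S p * E μ' (Fin.cons (circ ρ θ₀) (σS r S p)) ∂(Measure.pi (μS S))) μ =
      ∫ θ₀ in Icc 0 (2 * Real.pi), w₁ ρ (0, θ₀) *
        ∫ p, wS r S p * deriv (fun μ' : ℂ => E μ' (Fin.cons (circ ρ θ₀) (σS r S p))) μ ∂(Measure.pi (μS S)) := by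
  have h1 : ∀ j : Fin n, 1 < R j.succ := fun j => (hr j).trans (hrR j)
  have hR0 : 0 < R 0 := hρ.trans hρR
  -- near `μ`, the letter of `E(μ′)` is `Δ_S(∂E(μ′)∕∂t_□|₀)`
  have hloc : (fun μ' : ℂ => ∫ θ₀ in Icc 0 (2 * Real.pi), w₁ ρ (0, θ₀) *
      ∫ p, wS r S p * E μ' (Fin.cons (circ ρ θ₀) (σS r S p)) ∂(Measure.pi (μS S))) =ᶠ[𝓝 μ]
      fun μ' => mixedDiff n S (fun w => deriv (fun t : ℂ => E μ' (Fin.cons t w)) 0) := by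
    filter_upwards [hW.mem_nhds hμ] with μ' hμ'
    exact tBoxMixedLetter_eq_spectator hρ hρR hr hrR S hE hμ'
  rw [hloc.deriv_eq, deriv_mixedDiff_tDeriv_source hW hR0 h1 S hE hμ, mixedDiff_deriv_source_comm hW hR0 h1 S hE hμ]
  exact (tBoxMixedLetter_eq_spectator hρ hρR hr hrR S (E := fun μ' v => deriv (fun μ'' : ℂ => E μ'' v) μ')
    (analyticOnNhd_deriv_source hW hE) hμ).symm

/-- **… IN CLOSED FORM: `∂∕∂μ (1.23)(E(μ)) = Δ_S(∂_t|₀ ∂E∕∂μ(μ))`** [folklore] (the previous theorem read through W93∕W89 on the derivative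
field) — the source derivative of the (1.23) term is the decoupling-expansion term of the first `t_□`-variation of `∂E∕∂μ`. -/
theorem deriv_tBoxMixedLetter_source_eq_mixedDiff {W : Set ℂ} (hW : IsOpen W) {ρ : ℝ} (hρ : 0 < ρ) {r : Fin n → ℝ}
    {R : Fin (n + 1) → ℝ} (hρR : ρ < R 0) (hr : ∀ j, 1 < r j) (hrR : ∀ j : Fin n, r j < R j.succ) (S : Finset (Fin n))
    {E : ℂ → (Fin (n + 1) → ℂ) → ℂ}
    (hE : AnalyticOnNhd ℂ (fun q : ℂ × (Fin (n + 1) → ℂ) => E q.1 q.2) (W ×ˢ Set.univ.pi fun j => ball (0 : ℂ) (R j)))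
    {μ : ℂ} (hμ : μ ∈ W) :
    deriv (fun μ' : ℂ => ∫ θ₀ in Icc 0 (2 * Real.pi), w₁ ρ (0, θ₀) *
        ∫ p, wS r S p * E μ' (Fin.cons (circ ρ θ₀) (σS r S p)) ∂(Measure.pi (μS S))) μ =
      mixedDiff n S (fun w => deriv (fun t : ℂ => deriv (fun μ' : ℂ => E μ' (Fin.cons t w)) μ) 0) := by
  rw [deriv_tBoxMixedLetter_source hW hρ hρR hr hrR S hE hμ]
  exact tBoxMixedLetter_eq_spectator hρ hρR hr hrR S (E := fun μ' v => deriv (fun μ'' : ℂ => E μ'' v) μ')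
    (analyticOnNhd_deriv_source hW hE) hμ

/-! ## §3 AT EVERY ORDER: `∂^k∕∂μ^k (1.23)(E(·)) = (1.23)(∂^k E∕∂μ^k)` -/

/-- **ALL SOURCE DERIVATIVES COMMUTE INTO THE LETTER** (kernel; induction on `k`: Mathlib `iteratedDeriv_succ`, the induction hypothesis on
the OPEN `W` as a local identity (`Filter.EventuallyEq.deriv_eq`), then §2 `deriv_tBoxMixedLetter_source` applied to the jointly analytic field
`∂^k E∕∂μ^k` of §1): for `E` jointly analytic on `W × {|t| < R₀} × Π_j{|σ_j| < R_{j+1}}`, `0 < ρ < R₀`, `1 < r_j < R_{j+1}`, every `k` and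
every `μ ∈ W`,
`∂^k∕∂μ′^k|_μ ∫_{θ_□} w₁ ρ (0,θ_□)·(∫ wS r S p·E(μ′; circ ρ θ_□ ∷ σ_S p)) dθ_□ = ∫_{θ_□} w₁ ρ (0,θ_□)·(∫ wS r S p·∂^k E∕∂μ^k(μ; circ ρ θ_□ ∷ σ_S p)) dθ_□`
— the Taylor coefficients of the (1.23) term in the source are the (1.23) terms of the Taylor coefficients of the factor (the shape of the
cell's μ-expansion of the dressed terms, notes (n1)∕(n2) — a READING; nothing of print). [folklore] -/
theorem iteratedDeriv_tBoxMixedLetter_source {W : Set ℂ} (hW : IsOpen W) {ρ : ℝ} (hρ : 0 < ρ) {r : Fin n → ℝ} {R : Fin (n + 1) → ℝ}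
    (hρR : ρ < R 0) (hr : ∀ j, 1 < r j) (hrR : ∀ j : Fin n, r j < R j.succ) (S : Finset (Fin n)) {E : ℂ → (Fin (n + 1) → ℂ) → ℂ}
    (hE : AnalyticOnNhd ℂ (fun q : ℂ × (Fin (n + 1) → ℂ) => E q.1 q.2) (W ×ˢ Set.univ.pi fun j => ball (0 : ℂ) (R j))) :
    ∀ (k : ℕ) {μ : ℂ}, μ ∈ W →
      iteratedDeriv k (fun μ' : ℂ => ∫ θ₀ in Icc 0 (2 * Real.pi), w₁ ρ (0, θ₀) *
          ∫ p, wS r S p * E μ' (Fin.cons (circ ρ θ₀) (σS r S p)) ∂(Measure.pi (μS S))) μ =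
        ∫ θ₀ in Icc 0 (2 * Real.pi), w₁ ρ (0, θ₀) *
          ∫ p, wS r S p * iteratedDeriv k (fun μ' : ℂ => E μ' (Fin.cons (circ ρ θ₀) (σS r S p))) μ ∂(Measure.pi (μS S))
  | 0, μ, _ => by simp only [iteratedDeriv_zero]
  | k + 1, μ, hμ => by
      -- near `μ`, the `k`-th source derivative of the letter is the letter of `∂^k E∕∂μ^k` (induction hypothesis on the open `W`)
      have hloc : iteratedDeriv k (fun μ' : ℂ => ∫ θ₀ in Icc 0 (2 * Real.pi), w₁ ρ (0, θ₀) *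
          ∫ p, wS r S p * E μ' (Fin.cons (circ ρ θ₀) (σS r S p)) ∂(Measure.pi (μS S))) =ᶠ[𝓝 μ]
          fun μ' => ∫ θ₀ in Icc 0 (2 * Real.pi), w₁ ρ (0, θ₀) *
            ∫ p, wS r S p * iteratedDeriv k (fun μ'' : ℂ => E μ'' (Fin.cons (circ ρ θ₀) (σS r S p))) μ' ∂(Measure.pi (μS S)) := by
        filter_upwards [hW.mem_nhds hμ] with μ' hμ'
        exact iteratedDeriv_tBoxMixedLetter_source hW hρ hρR hr hrR S hE k hμ'
      rw [iteratedDeriv_succ, hloc.deriv_eq,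
        deriv_tBoxMixedLetter_source hW hρ hρR hr hrR S (E := fun μ' v => iteratedDeriv k (fun μ'' : ℂ => E μ'' v) μ')
          (analyticOnNhd_iteratedDeriv_source hW hE k) hμ]
      simp only [iteratedDeriv_succ]

/-! ## §4 (1.24)'s SHAPE FOR THE SOURCE DERIVATIVES; Cauchy on the factor itself -/

/-- [folklore] A point `t ∷ z` with `|t| = ρ < R₀` and `|z_j| ≤ e^{κ₁} < R_{j+1}` lies in the open polydisc. -/
theorem cons_mem_polyBall {ρ κ₁ : ℝ} {R : Fin (n + 1) → ℝ} (hρR : ρ < R 0) (hRκ : ∀ j : Fin n, Real.exp κ₁ < R j.succ) {t : ℂ}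
    (ht : ‖t‖ = ρ) {z : Fin n → ℂ} (hz : z ∈ polydisc (fun _ : Fin n => Real.exp κ₁)) :
    (Fin.cons t z : Fin (n + 1) → ℂ) ∈ Set.univ.pi fun j => ball (0 : ℂ) (R j) :=
  Set.mem_univ_pi.2 fun j => by
    induction j using Fin.cases with
    | zero => simpa [ht] using hρR
    | succ i => simpa using lt_of_le_of_lt (hz i) (hRκ i)

/-- **(1.24)'s THREE-FACTOR SHAPE FOR THE SOURCE DERIVATIVE, IN THE CURRENCY `sup‖∂E∕∂μ‖`** [folklore] (§2 + W89 `norm_tBoxMixedLetter_le` on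
the analytic section `∂E∕∂μ(μ; ·)`, W93 `analyticOnNhd_section`): with `κ₁ ≥ 1`, `R_{j+1} > e^{κ₁}`, `0 < ρ < R₀`, `1 < r_j < R_{j+1}`, `μ ∈ W`
and a bound `‖∂E∕∂μ(μ; t ∷ z)‖ ≤ A₁` for `|t| = ρ`, `|z_j| ≤ e^{κ₁}` (a HYPOTHESIS of (1.21)-TYPE for the derivative field),
`‖∂∕∂μ (1.23)(E(μ))‖ ≤ ρ⁻¹ · A₁ · e^{−(κ₁−1)·#S}`. -/
theorem norm_deriv_tBoxMixedLetter_source_le {W : Set ℂ} (hW : IsOpen W) {ρ : ℝ} (hρ : 0 < ρ) {r : Fin n → ℝ}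
    {R : Fin (n + 1) → ℝ} (hρR : ρ < R 0) (hr : ∀ j, 1 < r j) (hrR : ∀ j : Fin n, r j < R j.succ) {κ₁ A₁ : ℝ} (hκ : 1 ≤ κ₁)
    (hRκ : ∀ j : Fin n, Real.exp κ₁ < R j.succ) (S : Finset (Fin n)) {E : ℂ → (Fin (n + 1) → ℂ) → ℂ}
    (hE : AnalyticOnNhd ℂ (fun q : ℂ × (Fin (n + 1) → ℂ) => E q.1 q.2) (W ×ˢ Set.univ.pi fun j => ball (0 : ℂ) (R j)))
    {μ : ℂ} (hμ : μ ∈ W)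
    (hA₁ : ∀ t : ℂ, ‖t‖ = ρ → ∀ z ∈ polydisc (fun _ : Fin n => Real.exp κ₁), ‖deriv (fun μ' : ℂ => E μ' (Fin.cons t z)) μ‖ ≤ A₁) :
    ‖deriv (fun μ' : ℂ => ∫ θ₀ in Icc 0 (2 * Real.pi), w₁ ρ (0, θ₀) *
        ∫ p, wS r S p * E μ' (Fin.cons (circ ρ θ₀) (σS r S p)) ∂(Measure.pi (μS S))) μ‖ ≤
      ρ⁻¹ * (A₁ * Real.exp (-((κ₁ - 1) * S.card))) := by
  rw [deriv_tBoxMixedLetter_source hW hρ hρR hr hrR S hE hμ]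
  exact norm_tBoxMixedLetter_le hρ hρR hr hrR hκ hRκ S
    (analyticOnNhd_section (E := fun μ' v => deriv (fun μ'' : ℂ => E μ'' v) μ') (analyticOnNhd_deriv_source hW hE) hμ) hA₁

/-- **… AND FOR EVERY ORDER** [folklore] (§3 + W89 on the analytic section `∂^k E∕∂μ^k(μ; ·)`): under a bound `‖∂^k E∕∂μ^k(μ; t ∷ z)‖ ≤ A_k` on
`{|t| = ρ} × {|z_j| ≤ e^{κ₁}}`, `‖∂^k∕∂μ^k (1.23)(E(·))(μ)‖ ≤ ρ⁻¹ · A_k · e^{−(κ₁−1)·#S}`. -/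
theorem norm_iteratedDeriv_tBoxMixedLetter_source_le {W : Set ℂ} (hW : IsOpen W) {ρ : ℝ} (hρ : 0 < ρ) {r : Fin n → ℝ}
    {R : Fin (n + 1) → ℝ} (hρR : ρ < R 0) (hr : ∀ j, 1 < r j) (hrR : ∀ j : Fin n, r j < R j.succ) {κ₁ Ak : ℝ} (hκ : 1 ≤ κ₁)
    (hRκ : ∀ j : Fin n, Real.exp κ₁ < R j.succ) (S : Finset (Fin n)) {E : ℂ → (Fin (n + 1) → ℂ) → ℂ}
    (hE : AnalyticOnNhd ℂ (fun q : ℂ × (Fin (n + 1) → ℂ) => E q.1 q.2) (W ×ˢ Set.univ.pi fun j => ball (0 : ℂ) (R j)))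
    (k : ℕ) {μ : ℂ} (hμ : μ ∈ W)
    (hAk : ∀ t : ℂ, ‖t‖ = ρ → ∀ z ∈ polydisc (fun _ : Fin n => Real.exp κ₁),
      ‖iteratedDeriv k (fun μ' : ℂ => E μ' (Fin.cons t z)) μ‖ ≤ Ak) :
    ‖iteratedDeriv k (fun μ' : ℂ => ∫ θ₀ in Icc 0 (2 * Real.pi), w₁ ρ (0, θ₀) *
        ∫ p, wS r S p * E μ' (Fin.cons (circ ρ θ₀) (σS r S p)) ∂(Measure.pi (μS S))) μ‖ ≤
      ρ⁻¹ * (Ak * Real.exp (-((κ₁ - 1) * S.card))) := by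
  rw [iteratedDeriv_tBoxMixedLetter_source hW hρ hρR hr hrR S hE k hμ]
  exact norm_tBoxMixedLetter_le hρ hρR hr hrR hκ hRκ S
    (analyticOnNhd_section (E := fun μ' v => iteratedDeriv k (fun μ'' : ℂ => E μ'' v) μ') (analyticOnNhd_iteratedDeriv_source hW hE k) hμ)
    hAk

/-- **CAUCHY ON THE FACTOR ITSELF** [folklore] (W98 §1 `norm_deriv_le_of_strict_window` on the slice `μ′ ↦ E(μ′; v)`, holomorphic on
`{|μ′| < μ₁}` for `v` in the polydisc): `‖E(μ′; v)‖ ≤ A` for `|μ′| ≤ μ₁′` and the STRICT sub-window `μ₀ < μ₁′ < μ₁` give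
`‖∂E∕∂μ(μ; v)‖ ≤ A∕(μ₁′ − μ₀)` for `|μ| ≤ μ₀` — the currency `A₁` of the previous theorems supplied from a (1.21)-type bound on `E`. -/
theorem norm_deriv_source_le_of_strict_window {μ₁ μ₁' μ₀ : ℝ} (h01 : μ₀ < μ₁') (h1 : μ₁' < μ₁) {R : Fin (n + 1) → ℝ}
    {E : ℂ → (Fin (n + 1) → ℂ) → ℂ}
    (hE : AnalyticOnNhd ℂ (fun q : ℂ × (Fin (n + 1) → ℂ) => E q.1 q.2) (ball (0 : ℂ) μ₁ ×ˢ Set.univ.pi fun j => ball (0 : ℂ) (R j)))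
    {v : Fin (n + 1) → ℂ} (hv : v ∈ Set.univ.pi fun j => ball (0 : ℂ) (R j)) {A : ℝ} (hA : ∀ μ' ∈ closedBall (0 : ℂ) μ₁', ‖E μ' v‖ ≤ A)
    {μ : ℂ} (hμ : ‖μ‖ ≤ μ₀) :
    ‖deriv (fun μ' : ℂ => E μ' v) μ‖ ≤ A / (μ₁' - μ₀) :=
  norm_deriv_le_of_strict_window h01 h1
    ((hE.comp (analyticOnNhd_id.prod analyticOnNhd_const) fun _ hμ' => ⟨hμ', hv⟩).differentiableOn) hA hμ

/-! ## §5 Consistency with W98 and decided checks -/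

/-- CONSISTENCY CHECK (the two routes agree, BOTH BY NAME): on `|μ| ≤ μ₀ < μ₁′ < μ₁`, (i) W98 §3 `norm_deriv_letter_source_le` — Cauchy on
the holomorphic LETTER — gives `‖∂_μ (1.23)(μ)‖ ≤ ρ⁻¹·(A·e^{−(κ₁−1)·#S})∕(μ₁′ − μ₀)`; (ii) this file's route — commute the source derivative into
the letter (§2∕§4) and apply Cauchy's estimate to the FACTOR (`norm_deriv_source_le_of_strict_window`) — gives `ρ⁻¹·((A∕(μ₁′ − μ₀))·e^{−(κ₁−1)·#S})`;
(iii) the two numbers are equal.  W98's theorem is USED, not re-declared; this is an `example`. -/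
example {μ₁ μ₁' μ₀ ρ : ℝ} (h01 : μ₀ < μ₁') (h1 : μ₁' < μ₁) (hρ : 0 < ρ) {r : Fin n → ℝ} {R : Fin (n + 1) → ℝ} (hρR : ρ < R 0)
    (hr : ∀ j, 1 < r j) (hrR : ∀ j : Fin n, r j < R j.succ) {κ₁ A : ℝ} (hκ : 1 ≤ κ₁) (hRκ : ∀ j : Fin n, Real.exp κ₁ < R j.succ)
    (S : Finset (Fin n)) {E : ℂ → (Fin (n + 1) → ℂ) → ℂ}
    (hE : AnalyticOnNhd ℂ (fun q : ℂ × (Fin (n + 1) → ℂ) => E q.1 q.2) (ball (0 : ℂ) μ₁ ×ˢ Set.univ.pi fun j => ball (0 : ℂ) (R j)))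
    (hA : ∀ μ' ∈ closedBall (0 : ℂ) μ₁', ∀ t : ℂ, ‖t‖ = ρ → ∀ z ∈ polydisc (fun _ : Fin n => Real.exp κ₁), ‖E μ' (Fin.cons t z)‖ ≤ A)
    {μ : ℂ} (hμ : ‖μ‖ ≤ μ₀) :
    ‖deriv (fun μ' : ℂ => ∫ θ₀ in Icc 0 (2 * Real.pi), w₁ ρ (0, θ₀) *
        ∫ p, wS r S p * E μ' (Fin.cons (circ ρ θ₀) (σS r S p)) ∂(Measure.pi (μS S))) μ‖ ≤
      ρ⁻¹ * (A * Real.exp (-((κ₁ - 1) * S.card))) / (μ₁' - μ₀) ∧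
    ‖deriv (fun μ' : ℂ => ∫ θ₀ in Icc 0 (2 * Real.pi), w₁ ρ (0, θ₀) *
        ∫ p, wS r S p * E μ' (Fin.cons (circ ρ θ₀) (σS r S p)) ∂(Measure.pi (μS S))) μ‖ ≤
      ρ⁻¹ * (A / (μ₁' - μ₀) * Real.exp (-((κ₁ - 1) * S.card))) ∧
    ρ⁻¹ * (A / (μ₁' - μ₀) * Real.exp (-((κ₁ - 1) * S.card))) = ρ⁻¹ * (A * Real.exp (-((κ₁ - 1) * S.card))) / (μ₁' - μ₀) := by
  have hμW : μ ∈ ball (0 : ℂ) μ₁ := mem_ball_zero_iff.2 (lt_of_le_of_lt hμ (h01.trans h1))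
  refine ⟨norm_deriv_letter_source_le h01 h1 hρ hρR hr hrR hκ hRκ S hE hA hμ, ?_, by ring⟩
  exact norm_deriv_tBoxMixedLetter_source_le isOpen_ball hρ hρR hr hrR hκ hRκ S hE hμW (A₁ := A / (μ₁' - μ₀))
    fun t ht z hz => norm_deriv_source_le_of_strict_window h01 h1 hE (cons_mem_polyBall hρR hRκ ht hz)
      (fun μ' hμ' => hA μ' hμ' t ht z hz) hμ

/-- DECIDED CHECK, first order (W98's datum `E(μ; t, z₀, z₁) = μ²·t·z₀z₁`, source disc `|μ| < 2`, `t_□`-radius `1 < 2`, cube radii `3∕2 < 2`):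
through the COMMUTED form the source derivative of the letter at `μ = ½` is the letter of `∂_μ E(½) = 2·½·t·z₀z₁ = t·z₀z₁`, i.e.
`Δ_{01}(z₀z₁) = 1` — W98 §4's numeral, there obtained through `μ ↦ μ²`. -/
example : deriv (fun μ : ℂ => ∫ θ₀ in Icc 0 (2 * Real.pi), w₁ 1 (0, θ₀) *
    ∫ p : Fin 2 → ℝ × ℝ, wS (fun _ => (3 / 2 : ℝ)) {0, 1} p *
      (μ ^ 2 * circ 1 θ₀ * (σS (fun _ => (3 / 2 : ℝ)) {0, 1} p 0 * σS (fun _ => (3 / 2 : ℝ)) {0, 1} p 1)) ∂(Measure.pi (μS {0, 1})))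
    (1 / 2 : ℂ) = 1 := by
  have h := deriv_tBoxMixedLetter_source (n := 2) (W := ball (0 : ℂ) 2) isOpen_ball (ρ := 1) one_pos (r := fun _ => 3 / 2)
    (R := fun _ => 2) (by norm_num) (fun _ => by norm_num) (fun _ => by norm_num) {0, 1}
    (E := fun u v => u ^ 2 * v 0 * (v (Fin.succ 0) * v (Fin.succ 1))) (analyticOnNhd_source_toy _ _)
    (μ := 1 / 2) (by rw [mem_ball_zero_iff]; norm_num)
  simp only [Fin.cons_zero, Fin.cons_succ] at h
  rw [h]
  -- the source derivative of the factor: `∂_μ (μ²·a·b)|_{1/2} = a·b`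
  have hd : ∀ a b : ℂ, deriv (fun μ' : ℂ => μ' ^ 2 * a * b) (1 / 2 : ℂ) = a * b := fun a b => by
    rw [(((hasDerivAt_pow 2 (1 / 2 : ℂ)).mul_const a).mul_const b).deriv]
    norm_num
  simp_rw [hd]
  -- the letter of the ENTIRE factor `t·z₀z₁` is `Δ_{01}(∂_t(t·z₀z₁)|₀) = Δ_{01}(z₀z₁) = 1` (W89)
  have h2 := tBoxMixedLetter_eq_mixedDiff_deriv_local (n := 2) (ρ := 1) one_pos (r := fun _ => 3 / 2) (R := fun _ => 2) (by norm_num)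
    (fun _ => by norm_num) (fun _ => by norm_num) {0, 1} (E := fun v => v 0 * (v (Fin.succ 0) * v (Fin.succ 1)))
    ((((analyticOnNhd_apply 0).mul ((analyticOnNhd_apply _).mul (analyticOnNhd_apply _)))).mono (subset_univ _))
  simp only [Fin.cons_zero, Fin.cons_succ] at h2
  rw [h2]
  have hd' : ∀ w : Fin 2 → ℂ, HasDerivAt (fun t : ℂ => t * (w 0 * w 1)) (1 * (w 0 * w 1)) 0 := fun w => (hasDerivAt_id (0 : ℂ)).mul_const _
  simp_rw [(hd' _).deriv, mixedDiff_pair]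
  norm_num

/-- DECIDED CHECK, second order (§3 at `k = 2` on the same datum): at every source `|μ| < 2` the second source derivative of the letter is
the letter of `∂²_μ E = 2·t·z₀z₁`, i.e. `Δ_{01}(2·z₀z₁) = 2` (and the letter, `μ²`, is visibly a polynomial of degree two in the source). -/
example {μ : ℂ} (hμ : ‖μ‖ < 2) : iteratedDeriv 2 (fun μ' : ℂ => ∫ θ₀ in Icc 0 (2 * Real.pi), w₁ 1 (0, θ₀) *
    ∫ p : Fin 2 → ℝ × ℝ, wS (fun _ => (3 / 2 : ℝ)) {0, 1} p *
      (μ' ^ 2 * circ 1 θ₀ * (σS (fun _ => (3 / 2 : ℝ)) {0, 1} p 0 * σS (fun _ => (3 / 2 : ℝ)) {0, 1} p 1)) ∂(Measure.pi (μS {0, 1})))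
    μ = 2 := by
  have h := iteratedDeriv_tBoxMixedLetter_source (n := 2) (W := ball (0 : ℂ) 2) isOpen_ball (ρ := 1) one_pos (r := fun _ => 3 / 2)
    (R := fun _ => 2) (by norm_num) (fun _ => by norm_num) (fun _ => by norm_num) {0, 1}
    (E := fun u v => u ^ 2 * v 0 * (v (Fin.succ 0) * v (Fin.succ 1))) (analyticOnNhd_source_toy _ _) 2 (mem_ball_zero_iff.2 hμ)
  simp only [Fin.cons_zero, Fin.cons_succ] at h
  rw [h]
  -- the second source derivative of the factor: `∂²_μ (μ²·a·b) = 2·a·b`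
  have hd2 : ∀ a b : ℂ, iteratedDeriv 2 (fun μ' : ℂ => μ' ^ 2 * a * b) μ = 2 * (a * b) := fun a b => by
    have h1 : deriv (fun μ' : ℂ => μ' ^ 2 * a * b) = fun μ' => 2 * μ' * (a * b) := by
      funext x
      rw [(((hasDerivAt_pow 2 x).mul_const a).mul_const b).deriv]
      push_cast
      ring
    rw [iteratedDeriv_succ, iteratedDeriv_one, h1, (((hasDerivAt_id' μ).const_mul (2 : ℂ)).mul_const (a * b)).deriv]
    ring
  simp_rw [hd2]
  -- the letter of the ENTIRE factor `2·t·z₀z₁` is `Δ_{01}(2·z₀z₁) = 2` (W89)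
  have h2 := tBoxMixedLetter_eq_mixedDiff_deriv_local (n := 2) (ρ := 1) one_pos (r := fun _ => 3 / 2) (R := fun _ => 2) (by norm_num)
    (fun _ => by norm_num) (fun _ => by norm_num) {0, 1} (E := fun v => 2 * (v 0 * (v (Fin.succ 0) * v (Fin.succ 1))))
    ((analyticOnNhd_const.mul ((analyticOnNhd_apply 0).mul ((analyticOnNhd_apply _).mul (analyticOnNhd_apply _)))).mono (subset_univ _))
  simp only [Fin.cons_zero, Fin.cons_succ] at h2
  rw [h2]
  have hd' : ∀ w : Fin 2 → ℂ, HasDerivAt (fun t : ℂ => 2 * (t * (w 0 * w 1))) (2 * (1 * (w 0 * w 1))) 0 := fun w =>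
    ((hasDerivAt_id' (0 : ℂ)).mul_const _).const_mul _
  simp_rw [(hd' _).deriv, mixedDiff_pair]
  norm_num

end Summit.QuantumFields.BalabanUV.T4Continuum.NE1p.DressedSmallFieldTBoxMixedLetterSourceCommute

end
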